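import Summits.QuantumAdvantage.QuantumAdvantage.Theorems.CubicForrelationNearExactIsExactFlatSecondWeight
import Summits.QuantumAdvantage.QuantumAdvantage.Theorems.CubicForrelationNearExactIsExactTwelveLevelFiveGenericDead

/-!
# Crux `CubicForrelation.NearExactIsExact` (stmt-QuantumAdvantage-14043) — n = 12, open window `(57/64, 29/32)`, a LEVEL-5 side in CASE α:
  the set `A₂ = {y ∉ P : 4 ∤ e₅(y)}` is an 8-FLAT of exactly `256` points

Certificate seat `b2b-cforr-cert` (gen 29).  HONEST FRAMING: kernel-checked finite-slice lemmas (standard axioms) about cubic Boolean pairs on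
12 bits — the structure theorem for the first of the two NON-generic level-5 configurations left on the open window by gen 27
(`tzl5_window_structure`: case α = some point off the odd hyperplane has `4 ∤ e₅`; the other is the rigid case).  NO value of `θ₁₂` is claimed
and nothing is excluded here; NOT summit progress.  Plan: HOME/b2b-cforr-cert-g27/PLAN-N12-WINDOW-O5.md §A (case α), §C (2).

Setting.  Cubic `f, g` on 12 bits, `W_g = 32u'`, `P = {u' odd} = x₀ ⊕ V` (`#V = 2048`, `tzl5_hyperplane`), `e₅ = u' − 2(−1)^f` (even off `P`),
`c ∉ P` (so `c ⊕ V` is the complement of `P`), `A₂ = {y ∈ c ⊕ V : 4 ∤ e₅(y)}` = the odd set of `e₅/2` on the off-coset.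
* `tza_A2_flat`: if `A₂ ≠ ∅` and `#A₂ < 384` then `#A₂ = 256` and `A₂ = x₁ ⊕ V₁` for an xor-closed `V₁ ⊆ V` with `#V₁ = 256`, every `v ∈ V₁`
  preserving `4 ∣ e₅` along the off-coset.  [`2 ∣ Σ_{4-flat} e₅/2` by `l5c_flat4`; relative Kasami–Tokura `ffw_second_weight_int` (no weight of
  `RM(3,11)` in `(256, 384)`); relative minimum-weight words are flats, `ffw_minweight_flat_int`.]
* `tza_compl_coset`: the complement of the odd hyperplane is the coset of any of its points (bookkeeping).
* `tza_window_alpha`: packaging on the window `57/64 < Φ < 1` in case α: the hyperplane data, `A₂ = c ⊕ V₁` with `#V₁ = 256` (so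
  `#A₂ = 256`), the off-hyperplane energy is `≥ 1024`, and the total slack `Σ_P (e₅² − 1) + Σ_{off P} e₅² ≤ 1535` — hence at most `511` units
  remain for everything beyond the `256` points `e₅ ≡ 2 (mod 4)` of the flat (each of cost `≥ 4`).

References: T. Kasami, N. Tokura (1970) Thm 1; MacWilliams–Sloane (1977) Ch. 13 §3; J. Ax (1964) / R. J. McEliece (1972) for the flat
congruences already in the tree.  Axioms: the standard three.
-/

set_option linter.dupNamespace false -- D-0017: single-problem summit ⇒ `QuantumAdvantage.QuantumAdvantage` by design

noncomputable section

namespace Summit.QuantumAdvantage.QuantumAdvantage.Theorems.CubicForrelation.NearExactIsExact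

open Finset
open Literature.Computability.QuantumComplexity
open Literature.Computability.QuantumComplexity.BuzetChailloux (bxor zeroVec bxor_bxor_cancel_left bxor_zeroVec zeroVec_bxor bxor_comm
  bxor_self)
open Literature.Computability.QuantumComplexity.DerivativeWalsh (W)

/-! ### Case α: `A₂` is an 8-flat -/

/-- **Case α structure: `A₂` is an 8-flat of `256` points.**  Cubic `f, g` on 12 bits, `W_g = 32u'`, `{u' odd} = x₀ ⊕ V` (`#V = 2048`),
`c` with `u'(c)` even, `A₂ = {y ∈ c ⊕ V : 4 ∤ u'(y) − 2(−1)^{f(y)}}` non-empty with `#A₂ < 384`.  Then `#A₂ = 256` and `A₂ = x₁ ⊕ V₁` for every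
`x₁ ∈ A₂`, where `V₁ ⊆ V ∋ 0` is xor-closed with `#V₁ = 256` and translating by `V₁` preserves `4 ∣ e₅` along `c ⊕ V`. [this work] -/
theorem tza_A2_flat (f g : (Fin (6 + 6) → Bool) → Bool) (hf : IsDegLeFun 3 f) (hg : IsDegLeFun 3 g)
    (u' : (Fin (6 + 6) → Bool) → ℤ) (hu' : ∀ x, W (fun y => signOf (g y)) x = (2 : ℝ) ^ 5 * (u' x : ℝ))
    (V : Finset (Fin (6 + 6) → Bool)) (x₀ : Fin (6 + 6) → Bool) (h0 : zeroVec ∈ V) (hadd : ∀ a ∈ V, ∀ b ∈ V, bxor a b ∈ V)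
    (hcardV : #V = 2048) (hP : (univ.filter fun x : Fin (6 + 6) → Bool => Odd (u' x)) = V.image (bxor x₀))
    (c : Fin (6 + 6) → Bool) (hc : ¬ Odd (u' c))
    (hne : ∃ y ∈ V.image (bxor c), ¬ (4 : ℤ) ∣ u' y - 2 * sZ (f y))
    (hlt : #((V.image (bxor c)).filter fun y => ¬ (4 : ℤ) ∣ u' y - 2 * sZ (f y)) < 384) :
    #((V.image (bxor c)).filter fun y => ¬ (4 : ℤ) ∣ u' y - 2 * sZ (f y)) = 256 ∧
    ∃ V₁ : Finset (Fin (6 + 6) → Bool), V₁ ⊆ V ∧ zeroVec ∈ V₁ ∧ (∀ a ∈ V₁, ∀ b ∈ V₁, bxor a b ∈ V₁) ∧ #V₁ = 256 ∧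
      (∀ v ∈ V₁, ∀ y ∈ V.image (bxor c),
        ((4 : ℤ) ∣ u' (bxor y v) - 2 * sZ (f (bxor y v)) ↔ (4 : ℤ) ∣ u' y - 2 * sZ (f y))) ∧
      ∀ x₁ ∈ V.image (bxor c), ¬ (4 : ℤ) ∣ u' x₁ - 2 * sZ (f x₁) →
        ((V.image (bxor c)).filter fun y => ¬ (4 : ℤ) ∣ u' y - 2 * sZ (f y)) = V₁.image (bxor x₁) := by
  classical
  set P := univ.filter (fun x : Fin (6 + 6) → Bool => Odd (u' x)) with hPdef
  set e : (Fin (6 + 6) → Bool) → ℤ := fun x => u' x - 2 * sZ (f x) with hedef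
  have hcardV11 : #V = 2 ^ 11 := by rw [hcardV]; norm_num
  have hcP : c ∉ P := fun h => hc (mem_filter.1 h).2
  have hPV' : ∀ x, x ∉ P → ∀ a ∈ V, bxor x a ∉ P := fun x hx a ha => fl1_coset_out' hadd hP hx ha
  have hcos_out : ∀ b ∈ V.image (bxor c), b ∉ P := by
    intro b hb
    obtain ⟨v, hv, rfl⟩ := mem_image.1 hb
    exact hPV' c hcP v hv
  have heven : ∀ y, y ∉ P → Even (e y) := by
    intro y hy
    have hy' : ¬ Odd (u' y) := fun h => hy (mem_filter.2 ⟨mem_univ _, h⟩)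
    obtain ⟨m, hm⟩ := Int.not_odd_iff_even.1 hy'
    exact ⟨m - sZ (f y), by simp only [e]; rw [hm]; ring⟩
  have hp2 : ∀ y, y ∉ P → e y = 2 * (e y / 2) := fun y hy =>
    (Int.mul_ediv_cancel' (even_iff_two_dvd.1 (heven y hy))).symm
  -- `4 ∤ e ↔ e/2 odd` off `P`
  have hodd4 : ∀ y, y ∉ P → (Odd (e y / 2) ↔ ¬ (4 : ℤ) ∣ e y) := by
    intro y hy
    have h2 := hp2 y hy
    constructor
    · intro hodd h4
      obtain ⟨k, hk⟩ := h4
      rw [Int.odd_iff] at hodd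
      omega
    · intro h4
      rw [Int.odd_iff]
      by_contra hne'
      exact h4 ⟨e y / 2 / 2, by omega⟩
  -- `2 ∣ Σ_{4-flat} e/2` on the off-coset
  have H : ∀ b ∈ V.image (bxor c), ∀ a : Fin 4 → Fin (6 + 6) → Bool, (∀ i, a i ∈ V) →
      (2 : ℤ) ∣ ∑ ε : Fin 4 → Bool, (fun y => e y / 2) (fun j => b j ^^ decide (Odd #(univ.filter fun i => ε i && a i j))) := by
    intro b hb a ha
    have hpts : ∀ ε : Fin 4 → Bool, (fun j => b j ^^ decide (Odd #(univ.filter fun i => ε i && a i j))) ∉ P :=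
      fun ε => ws_flatPt_mem V h0 (· ∉ P) hPV' 4 b (hcos_out b hb) a ha ε
    have h4 : (4 : ℤ) ∣ ∑ ε : Fin 4 → Bool, e (fun j => b j ^^ decide (Odd #(univ.filter fun i => ε i && a i j))) :=
      l5c_flat4 f g hf hg u' hu' b a
    rw [sum_congr rfl fun ε _ => hp2 _ (hpts ε), ← mul_sum] at h4
    obtain ⟨k, hk⟩ := h4
    exact ⟨k, by linarith⟩
  -- the odd set of `e/2` is `A₂`
  have e1 : ((V.image (bxor c)).filter fun x => Odd (e x / 2)) = (V.image (bxor c)).filter fun y => ¬ (4 : ℤ) ∣ e y :=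
    filter_congr fun y hy => hodd4 y (hcos_out y hy)
  -- Kasami–Tokura: `#A₂ = 256`
  have hlt' : 2 ^ (3 + 1) * #((V.image (bxor c)).filter fun x => Odd (e x / 2)) < 3 * 2 ^ 11 := by
    rw [e1]; norm_num
    have : #((V.image (bxor c)).filter fun y => ¬ (4 : ℤ) ∣ e y) < 384 := hlt
    omega
  rcases ffw_second_weight_int (r := 3) (m := 11) (by norm_num) V h0 hadd hcardV11 c (fun y => e y / 2) H hlt' with hall | hcount
  · exfalso
    obtain ⟨y, hy, hy4⟩ := hne
    have hev := hall y hy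
    have : ¬ Odd (e y / 2) := Int.not_odd_iff_even.2 hev
    exact this ((hodd4 y (hcos_out y hy)).2 hy4)
  rw [e1] at hcount
  have h256 : #((V.image (bxor c)).filter fun y => ¬ (4 : ℤ) ∣ e y) = 256 := by
    norm_num at hcount; omega
  refine ⟨h256, ?_⟩
  -- minimum weight ⇒ flat
  have hS : 2 ^ (2 + 1) * #((V.image (bxor c)).filter fun x => Odd (e x / 2)) = 2 ^ 11 := by rw [e1, h256]; norm_num
  obtain ⟨V₁, hsub, h10, h1add, h1card, hper, hstr⟩ :=
    ffw_minweight_flat_int (d := 2) (m := 11) V h0 hadd hcardV11 c (fun y => e y / 2) H hS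
  rw [e1] at h1card hstr
  refine ⟨V₁, hsub, h10, h1add, by rw [h1card, h256], ?_, ?_⟩
  · intro v hv y hy
    have hyv : bxor y v ∈ V.image (bxor c) := by
      obtain ⟨w, hw, rfl⟩ := mem_image.1 hy
      exact mem_image.2 ⟨bxor w v, hadd w hw v (hsub hv), (iw_bxor_assoc c w v).symm⟩
    have h1 := hper v hv y hy
    have h2 := hodd4 (bxor y v) (hcos_out _ hyv)
    have h3 := hodd4 y (hcos_out y hy)
    show (4 : ℤ) ∣ e (bxor y v) ↔ (4 : ℤ) ∣ e y
    tauto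
  · intro x₁ hx₁ hx₁4
    exact hstr x₁ hx₁ ((hodd4 x₁ (hcos_out x₁ hx₁)).2 hx₁4)

/-! ### Bookkeeping: the complement of the odd hyperplane -/

/-- The complement of the odd hyperplane `x₀ ⊕ V` (`#V = 2048`, half of `𝔽₂¹²`) is the coset `c ⊕ V` of any point `c` with `u'(c)` even.
[folklore] -/
theorem tza_compl_coset (u' : (Fin (6 + 6) → Bool) → ℤ)
    (V : Finset (Fin (6 + 6) → Bool)) (x₀ : Fin (6 + 6) → Bool) (hadd : ∀ a ∈ V, ∀ b ∈ V, bxor a b ∈ V)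
    (hcardV : #V = 2048) (hP : (univ.filter fun x : Fin (6 + 6) → Bool => Odd (u' x)) = V.image (bxor x₀))
    (c : Fin (6 + 6) → Bool) (hc : ¬ Odd (u' c)) :
    (univ.filter fun x : Fin (6 + 6) → Bool => ¬ Odd (u' x)) = V.image (bxor c) := by
  classical
  set P := univ.filter (fun x : Fin (6 + 6) → Bool => Odd (u' x)) with hPdef
  set P' := univ.filter (fun x : Fin (6 + 6) → Bool => ¬ Odd (u' x)) with hP'def
  have hcP : c ∉ P := fun h => hc (mem_filter.1 h).2
  have hinj : ∀ z : Fin (6 + 6) → Bool, Function.Injective (bxor z) := fun z a b h => by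
    have := congrArg (bxor z) h; rwa [bxor_bxor_cancel_left, bxor_bxor_cancel_left] at this
  have hcardP : #P = 2048 := by rw [hP, card_image_of_injective _ (hinj x₀), hcardV]
  have hPP' : #P + #P' = 4096 := by
    have h := Finset.card_filter_add_card_filter_not (s := (univ : Finset (Fin (6 + 6) → Bool))) (fun x => Odd (u' x))
    rw [card_univ, Fintype.card_fun, Fintype.card_bool, Fintype.card_fin] at h
    rw [show (2 : ℕ) ^ (6 + 6) = 4096 by norm_num] at h
    exact h
  have hcardP' : #P' = 2048 := by omega
  have hsub : V.image (bxor c) ⊆ P' := by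
    intro y hy
    obtain ⟨a, ha, rfl⟩ := mem_image.1 hy
    have hout : bxor c a ∉ P := fl1_coset_out' hadd hP hcP ha
    exact mem_filter.2 ⟨mem_univ _, fun h => hout (mem_filter.2 ⟨mem_univ _, h⟩)⟩
  symm
  exact eq_of_subset_of_card_le hsub (by rw [card_image_of_injective _ (hinj c), hcardV, hcardP'])

/-! ### Packaging on the open window -/

/-- **Case α on the open window (packaging).**  Cubic `f, g` on 12 bits, `W_g = 32u'` with some `u'` odd, `57/64 < Φ(f,g)` (the upper bound
`Φ < 1` of the window is not needed), and some point off the odd set with `4 ∤ e₅ = u' − 2(−1)^f` (case α of `tzl5_window_structure`).  Then: the odd set is a hyperplane `x₀ ⊕ V`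
(`#V = 2048`), its complement is `c ⊕ V` with `c ∈ A₂`, and `A₂ = {u' even, 4 ∤ e₅} = c ⊕ V₁` for an xor-closed `V₁ ⊆ V` with `#V₁ = 256`
(translating by `V₁` preserves `4 ∣ e₅` off the hyperplane); the off-hyperplane energy is `≥ 1024` and the total slack is
`Σ_P (e₅² − 1) + Σ_{off P} e₅² ≤ 1535`.  Finite-slice statement, NOT summit progress. [this work] -/
theorem tza_window_alpha (f g : (Fin (6 + 6) → Bool) → Bool) (hf : IsDegLeFun 3 f) (hg : IsDegLeFun 3 g)
    (u' : (Fin (6 + 6) → Bool) → ℤ) (hu' : ∀ x, W (fun y => signOf (g y)) x = (2 : ℝ) ^ 5 * (u' x : ℝ)) (hodd : ∃ x, Odd (u' x))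
    (hlo : (57 / 64 : ℝ) < forrelation f g)
    (hα : ∃ y, ¬ Odd (u' y) ∧ ¬ (4 : ℤ) ∣ u' y - 2 * sZ (f y)) :
    ∃ (V : Finset (Fin (6 + 6) → Bool)) (x₀ c : Fin (6 + 6) → Bool) (V₁ : Finset (Fin (6 + 6) → Bool)),
      zeroVec ∈ V ∧ (∀ a ∈ V, ∀ b ∈ V, bxor a b ∈ V) ∧ #V = 2048 ∧
      (univ.filter fun x : Fin (6 + 6) → Bool => Odd (u' x)) = V.image (bxor x₀) ∧
      ¬ Odd (u' c) ∧ ¬ (4 : ℤ) ∣ u' c - 2 * sZ (f c) ∧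
      (univ.filter fun x : Fin (6 + 6) → Bool => ¬ Odd (u' x)) = V.image (bxor c) ∧
      V₁ ⊆ V ∧ zeroVec ∈ V₁ ∧ (∀ a ∈ V₁, ∀ b ∈ V₁, bxor a b ∈ V₁) ∧ #V₁ = 256 ∧
      (univ.filter fun y : Fin (6 + 6) → Bool => ¬ Odd (u' y) ∧ ¬ (4 : ℤ) ∣ u' y - 2 * sZ (f y)) = V₁.image (bxor c) ∧
      (∀ v ∈ V₁, ∀ y, ¬ Odd (u' y) →
        ((4 : ℤ) ∣ u' (bxor y v) - 2 * sZ (f (bxor y v)) ↔ (4 : ℤ) ∣ u' y - 2 * sZ (f y))) ∧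
      1024 ≤ ∑ y ∈ univ.filter (fun y : Fin (6 + 6) → Bool => ¬ Odd (u' y)), (u' y - 2 * sZ (f y)) ^ 2 ∧
      ∑ x ∈ univ.filter (fun x : Fin (6 + 6) → Bool => Odd (u' x)), ((u' x - 2 * sZ (f x)) ^ 2 - 1) +
        ∑ y ∈ univ.filter (fun y : Fin (6 + 6) → Bool => ¬ Odd (u' y)), (u' y - 2 * sZ (f y)) ^ 2 ≤ 1535 := by
  classical
  set P := univ.filter (fun x : Fin (6 + 6) → Bool => Odd (u' x)) with hPdef
  set P' := univ.filter (fun x : Fin (6 + 6) → Bool => ¬ Odd (u' x)) with hP'def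
  set e : (Fin (6 + 6) → Bool) → ℤ := fun x => u' x - 2 * sZ (f x) with hedef
  obtain ⟨c, hc, hc4⟩ := hα
  -- budget `Σ e² = 32768(1 − Φ) < 3584`
  set u : (Fin (6 + 6) → Bool) → ℤ := fun x => 2 * u' x with hudef
  have hu : ∀ x, W (fun y => signOf (g y)) x = (2 : ℝ) ^ 4 * (u x : ℝ) := by
    intro x; rw [hu' x]; simp only [u]; push_cast; ring
  have hbud := tw12_budget f g u hu
  have h4e : ∀ x, (u x - 4 * sZ (f x)) ^ 2 = 4 * e x ^ 2 := fun x => by simp only [u, e]; ring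
  have hBR : ((∑ x, e x ^ 2 : ℤ) : ℝ) = 32768 * (1 - forrelation f g) := by
    have h' : ((∑ x, (u x - 4 * sZ (f x)) ^ 2 : ℤ) : ℝ) = 4 * ((∑ x, e x ^ 2 : ℤ) : ℝ) := by
      rw [sum_congr rfl fun x _ => h4e x, ← mul_sum]; push_cast; ring
    rw [h'] at hbud
    linarith
  have hB : (∑ x, e x ^ 2 : ℤ) ≤ 3583 := by
    have h' : ((∑ x, e x ^ 2 : ℤ) : ℝ) < 3584 := by rw [hBR]; linarith
    have h'' : (∑ x, e x ^ 2 : ℤ) < 3584 := by exact_mod_cast h'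
    omega
  -- the hyperplane and its complement
  obtain ⟨V, x₀, h0, hadd, hcardV, hP⟩ := tzl5_hyperplane g hg u' hu' hodd ⟨c, hc⟩
  have hP' : P' = V.image (bxor c) := tza_compl_coset u' V x₀ hadd hcardV hP c hc
  have hmemP' : ∀ y, y ∈ V.image (bxor c) ↔ ¬ Odd (u' y) := fun y => by rw [← hP']; simp [hP'def]
  -- the split of the budget
  have hsplit : (∑ x, e x ^ 2 : ℤ) = ∑ x ∈ P, e x ^ 2 + ∑ y ∈ P', e y ^ 2 :=
    (sum_filter_add_sum_filter_not (s := (univ : Finset (Fin (6 + 6) → Bool))) (p := fun x => Odd (u' x)) (f := fun x => e x ^ 2)).symm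
  have heodd : ∀ x, Odd (u' x) → Odd (e x) := fun x hx => Int.odd_sub.2 (iff_of_true hx ⟨sZ (f x), two_mul _⟩)
  have hPge : ∀ x ∈ P, (1 : ℤ) ≤ e x ^ 2 := by
    intro x hx
    have h1 := Int.odd_iff.1 (heodd x (mem_filter.1 hx).2)
    have : e x ≤ -1 ∨ 1 ≤ e x := by omega
    rcases this with h | h <;> nlinarith
  have hPsum : ∑ x ∈ P, (e x ^ 2 - 1) = ∑ x ∈ P, e x ^ 2 - #P := by
    rw [sum_sub_distrib, sum_const, nsmul_eq_mul, mul_one]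
  have hinj : Function.Injective (bxor x₀) := fun a b h => by
    have := congrArg (bxor x₀) h; rwa [bxor_bxor_cancel_left, bxor_bxor_cancel_left] at this
  have hcardP : #P = 2048 := by rw [hPdef, hP, card_image_of_injective _ hinj, hcardV]
  -- the flat structure of `A₂`
  have hA2 := tza_A2_flat f g hf hg u' hu' V x₀ h0 hadd hcardV hP c hc
    ⟨c, mem_image.2 ⟨zeroVec, h0, bxor_zeroVec c⟩, hc4⟩
  -- `#A₂ < 384` from the budget: each point costs `≥ 4`, the hyperplane costs `≥ 2048`
  set A₂ := (V.image (bxor c)).filter (fun y => ¬ (4 : ℤ) ∣ e y) with hA₂def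
  have hA2sub : A₂ ⊆ P' := by
    intro y hy; rw [hP']; exact (mem_filter.1 hy).1
  have hcost : ∀ y ∈ A₂, (4 : ℤ) ≤ e y ^ 2 := by
    intro y hy
    obtain ⟨hy1, hy4⟩ := mem_filter.1 hy
    have hyP : ¬ Odd (u' y) := (hmemP' y).1 hy1
    obtain ⟨m, hm⟩ := Int.not_odd_iff_even.1 hyP
    have hev : e y = 2 * (m - sZ (f y)) := by simp only [e]; rw [hm]; ring
    have hm0 : m - sZ (f y) ≠ 0 := by
      intro h0'
      apply hy4
      show (4 : ℤ) ∣ e y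
      rw [hev, h0', mul_zero]; exact dvd_zero 4
    have : e y ≤ -2 ∨ 2 ≤ e y := by omega
    rcases this with h | h <;> nlinarith
  have hA2energy : 4 * (#A₂ : ℤ) ≤ ∑ y ∈ P', e y ^ 2 :=
    calc 4 * (#A₂ : ℤ) = ∑ y ∈ A₂, (4 : ℤ) := by rw [sum_const, nsmul_eq_mul, mul_comm]
      _ ≤ ∑ y ∈ A₂, e y ^ 2 := sum_le_sum hcost
      _ ≤ ∑ y ∈ P', e y ^ 2 := sum_le_sum_of_subset_of_nonneg hA2sub fun _ _ _ => sq_nonneg _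
  have hPenergy : (2048 : ℤ) ≤ ∑ x ∈ P, e x ^ 2 := by
    calc (2048 : ℤ) = ∑ x ∈ P, (1 : ℤ) := by rw [sum_const, nsmul_eq_mul, mul_one, hcardP]; norm_num
      _ ≤ ∑ x ∈ P, e x ^ 2 := sum_le_sum hPge
  have hA2lt : #A₂ < 384 := by
    have : 4 * (#A₂ : ℤ) ≤ 1535 := by linarith
    have : (#A₂ : ℤ) < 384 := by linarith
    exact_mod_cast this
  obtain ⟨h256, V₁, hsub, h10, h1add, h1card, hper, hstr⟩ := hA2 hA2lt
  have hA2eq := hstr c (mem_image.2 ⟨zeroVec, h0, bxor_zeroVec c⟩) hc4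
  refine ⟨V, x₀, c, V₁, h0, hadd, hcardV, hP, hc, hc4, hP', hsub, h10, h1add, h1card, ?_, ?_, ?_, ?_⟩
  · -- `{u' even, 4 ∤ e}` is `A₂`
    rw [← hA2eq]
    ext y
    simp only [hA₂def, mem_filter, mem_univ, true_and]
    constructor
    · rintro ⟨hy, hy4⟩; exact ⟨(hmemP' y).2 hy, hy4⟩
    · rintro ⟨hy, hy4⟩; exact ⟨(hmemP' y).1 hy, hy4⟩
  · intro v hv y hy
    exact hper v hv y ((hmemP' y).2 hy)
  · have h256' : (256 : ℤ) ≤ #A₂ := by rw [h256]; norm_num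
    show (1024 : ℤ) ≤ ∑ y ∈ P', e y ^ 2
    linarith
  · show ∑ x ∈ P, (e x ^ 2 - 1) + ∑ y ∈ P', e y ^ 2 ≤ 1535
    rw [hPsum, hcardP]
    push_cast
    linarith

end Summit.QuantumAdvantage.QuantumAdvantage.Theorems.CubicForrelation.NearExactIsExact

end
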